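import Summits.AtomisticToContinuum.FouriersLaw.Theorems.BondHeatUncertaintyExtensiveSnapshotIrreversibilityTotalGreenKuboCapAux1

/-!
# The equilibrium conductance cap `0 ≤ ⟨u, J⟩_{μ_T} ≤ γ T² (N−1)²` (stub S_B of line tap-duality-gk-time)

Helper file `--supports stmt-AtomisticToContinuum-9121`
(`BondHeatUncertainty.ExtensiveSnapshotIrreversibility`), stub `stub_totalGreenKuboCap` of the
line `tap-duality-gk-time`, part II (part I: `…TotalGreenKuboCapAux1`, the contact identity).

For the pinned anharmonic chain `P = pinnedChain ω₂ lam β γ` (all parameters `> 0`), `N ≥ 2`,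
`T > 0`, the total current `J = ∑_i j_i`, the normalised Gibbs measure `μ_T` and ANY `μ_T`-a.e.
limit `u` of the finite-horizon Kubo correctors `∫₀^τ P_t J dt`:

  `0 ≤ ∫ u J dμ_T ≤ γ T² (N − 1)²`        (`stub_totalGreenKuboCap`, the conductance cap `G_N ≤ γ`).

Proof (everything for the smooth corrector `u₀` of `corrector_smooth`, `L u₀ = -J`, then
`u = u₀` `μ_T`-a.e. by uniqueness of limits, `corrector_exists`):
* `0 ≤`: the tap energy identity `∫ u₀ J ρ = γ T (‖∂_{p_0} u₀‖²_ρ + ‖∂_{p_{N-1}} u₀‖²_ρ)`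
  (`integral_mul_source_eq_dirichlet`), `ρ = e^{-H/T}`;
* bond sum rule (`bond_sum_rule_density`) and `j_{N-1} ≡ 0`: `∫ u₀ J ρ = (N-1) x`,
  `x = ∫ u₀ j_{N-2} ρ`;
* contact identity at the right bath (part I): `x = -γ T ∫ p_{N-1} ∂_{p_{N-1}} u₀ ρ`;
* Cauchy–Schwarz and equipartition `∫ p² ρ = T Z` (`Z = ∫ ρ`):
  `x² ≤ γ² T³ Z ‖∂_{p_{N-1}} u₀‖²_ρ ≤ γ T² Z (N-1) x`, hence `(N-1) x ≤ γ T² (N-1)² Z`; divide by `Z`.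

References: Kundu–Dhar–Narayan 2009 (reln3); Bonetto–Lebowitz–Rey-Bellet 2000 §5.2; folklore.
-/

noncomputable section

namespace Summit.AtomisticToContinuum.FouriersLaw.Theorems.ExtensiveSnapshotIrreversibility.TapDuality

open MeasureTheory Filter Topology
open scoped ENNReal NNReal ContDiff
open Literature.MathematicalPhysics.KineticTheory.HeatConduction
open Summit.AtomisticToContinuum.FouriersLaw.Theorems.OddSectorIrreversibility.Corrector
open Summit.AtomisticToContinuum.FouriersLaw.Theorems.SuperadditiveResistance.DeviceLiouville
open Summit.AtomisticToContinuum.FouriersLaw.Theorems.SuperadditiveResistance.Kubo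
open Summit.AtomisticToContinuum.FouriersLaw.Theorems.SubdiffusiveBondHeat

variable {N : ℕ}

section Pinned

variable {ω₂ lam β γ : ℝ} (hω : 0 < ω₂) (hl : 0 ≤ lam) (hβ : 0 ≤ β) {T : ℝ} (hT : 0 < T) (hγ : 0 < γ)
include hω hl hβ hT hγ


/-- **The conductance cap in density form.** For `N ≥ 2` and a classical solution
`u ∈ C² ∩ L²(μ_T)` of `L_{T,T} u = -J` (`J = ∑_i j_i` the total current), with `ρ = e^{-H/T}`,
`Z = ∫ ρ`: `0 ≤ ∫ u J ρ ≤ γ T² (N-1)² Z`. Tap energy identity for `0 ≤`; bond sum rule, the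
contact identity at the right bath, Cauchy–Schwarz and equipartition `∫ p_{N-1}² ρ = T Z` for `≤`.
[folklore] -/
theorem integral_mul_totalBondCurrent_mul_gibbsDensity_le (hN : 2 ≤ N) {u : PhaseSpace N → ℝ}
    (hu : ContDiff ℝ 2 u) (hu2 : MemLp u 2 ((pinnedChain ω₂ lam β γ).gibbsMeasure N T))
    (hpde : ∀ x, (pinnedChain ω₂ lam β γ).generator N T T u x =
      -(∑ i : Fin N, (pinnedChain ω₂ lam β γ).bondCurrent N i x)) :
    0 ≤ ∫ x, u x * (∑ i : Fin N, (pinnedChain ω₂ lam β γ).bondCurrent N i x) *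
        (pinnedChain ω₂ lam β γ).gibbsDensity N T x ∧
      ∫ x, u x * (∑ i : Fin N, (pinnedChain ω₂ lam β γ).bondCurrent N i x) *
          (pinnedChain ω₂ lam β γ).gibbsDensity N T x ≤
        γ * T ^ 2 * ((N : ℝ) - 1) ^ 2 * ∫ x, (pinnedChain ω₂ lam β γ).gibbsDensity N T x := by
  set P := pinnedChain ω₂ lam β γ with hP
  set ρ := P.gibbsDensity N T with hρ
  set J : PhaseSpace N → ℝ := fun x => ∑ i : Fin N, P.bondCurrent N i x with hJ
  change 0 ≤ ∫ x, u x * J x * ρ x ∧ ∫ x, u x * J x * ρ x ≤ γ * T ^ 2 * ((N : ℝ) - 1) ^ 2 * ∫ x, ρ x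
  -- the total current
  have hJc : Continuous J := continuous_totalBondCurrent ω₂ lam β γ N
  have hϑ : 0 < 1 / (4 * T) := by positivity
  have h2ϑ : 2 * (1 / (4 * T)) < 1 / T := by
    rw [show 2 * (1 / (4 * T)) = 1 / (2 * T) by field_simp; ring, div_lt_div_iff₀ (by positivity) hT]
    nlinarith
  obtain ⟨M, -, hJM⟩ := abs_totalBondCurrent_le_exp hω.le hl hβ γ N hϑ
  have hJ2 : MemLp J 2 (P.gibbsMeasure N T) := memLp_two_of_abs_le_exp hω hl hβ hT γ hJc h2ϑ hJM
  have hJodd : ∀ x : PhaseSpace N, J (x.1, -x.2) = -J x := fun x => totalBondCurrent_neg_momentum P N x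
  have hpde' : ∀ x, P.generator N T T u x = -J x := hpde
  -- the bath sites `b₀ = 0`, `b₁ = N - 1` and the last bond `i₁ = N - 2`
  set b₀ : Fin N := ⟨0, by omega⟩ with hb₀
  set b₁ : Fin N := ⟨N - 1, by omega⟩ with hb₁
  set i₁ : Fin N := ⟨N - 2, by omega⟩ with hi₁
  have hρ0 : ∀ x, 0 < ρ x := fun x => P.gibbsDensity_pos N T x
  set Z := ∫ x, ρ x with hZ
  have hZ0 : 0 < Z := integral_exp_pos (pinnedChain_integrable_gibbsDensity hω hl hβ γ N hT)
  set A := ∫ x, u x * J x * ρ x with hA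
  set D₀ := ∫ x, partialP b₀ u x ^ 2 * ρ x with hD₀
  set D₁ := ∫ x, partialP b₁ u x ^ 2 * ρ x with hD₁
  have hD₀0 : 0 ≤ D₀ := integral_nonneg fun x => mul_nonneg (sq_nonneg _) (hρ0 x).le
  have hD₁0 : 0 ≤ D₁ := integral_nonneg fun x => mul_nonneg (sq_nonneg _) (hρ0 x).le
  -- (6) the tap energy identity
  have hE : A = γ * T * (D₀ + D₁) := by
    have h := integral_mul_source_eq_dirichlet hω hl hβ hγ hT hu hu2 hJc hJ2 hpde'
    rw [sum_bathWeight_mul (fun i => ∫ x, partialP i u x ^ 2 * ρ x) (show b₀.val = 0 from rfl)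
      (show b₁.val = N - 1 from rfl)] at h
    exact h
  have hA0 : 0 ≤ A := by rw [hE]; positivity
  refine ⟨hA0, ?_⟩
  -- (5) the bond sum rule: `A = (N - 1) x₁`, `x₁ = ∫ u j_{N-2} ρ`
  set x₁ := ∫ x, u x * P.bondCurrent N i₁ x * ρ x with hx₁
  have hji : ∀ j : Fin N, MemLp (fun x => P.bondCurrent N j x) 2 (P.gibbsMeasure N T) :=
    fun j => memLp_bondCurrent hω hl hβ hT γ j
  have heach : ∀ (k : ℕ) (i : Fin N), i.val + 2 + k = N →
      ∫ x, u x * P.bondCurrent N i x * ρ x = x₁ := by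
    intro k
    induction k with
    | zero =>
      intro i hi
      have : i = i₁ := Fin.ext (by simp only [hi₁]; omega)
      rw [this]
    | succ k ih =>
      intro i hi
      have hlt : i.val + 1 < N := by omega
      rw [bond_sum_rule_density hω hl hβ hT hγ hu hu2 hJc hJ2 hJodd hpde' (i := i)
        (i' := ⟨i.val + 1, hlt⟩) rfl (by simp only; omega)]
      exact ih ⟨i.val + 1, hlt⟩ (by simp only; omega)
  have hlast : ∀ x, P.bondCurrent N b₁ x = 0 := fun x =>
    bondCurrent_eq_zero_of_succ_eq P b₁ (by simp only [hb₁]; omega) x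
  have hS : A = ((N : ℝ) - 1) * x₁ := by
    have hint : ∀ i : Fin N, Integrable fun x => u x * P.bondCurrent N i x * ρ x :=
      fun i => integrable_mul_mul_gibbsDensity hω hl hβ γ N hT hu2 (hji i)
    have h1 : A = ∑ i : Fin N, ∫ x, u x * P.bondCurrent N i x * ρ x := by
      rw [hA, ← integral_finsetSum _ fun i _ => hint i]
      refine integral_congr_ae (Eventually.of_forall fun x => ?_)
      simp only [hJ, Finset.mul_sum, Finset.sum_mul]
    have h2 : ∑ i : Fin N, ∫ x, u x * P.bondCurrent N i x * ρ x =
        ∑ i ∈ Finset.univ.erase b₁, ∫ x, u x * P.bondCurrent N i x * ρ x := by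
      rw [← Finset.sum_erase_add _ _ (Finset.mem_univ b₁)]
      simp only [hlast, mul_zero, zero_mul, integral_zero, add_zero]
    have h3 : ∑ i ∈ Finset.univ.erase b₁, ∫ x, u x * P.bondCurrent N i x * ρ x =
        ∑ i ∈ Finset.univ.erase b₁, x₁ := by
      refine Finset.sum_congr rfl fun i hi => ?_
      have hne : i ≠ b₁ := Finset.ne_of_mem_erase hi
      have hiN : i.val ≠ N - 1 := fun h => hne (Fin.ext (by rw [hb₁]; exact h))
      have hlt := i.isLt
      exact heach (N - (i.val + 2)) i (by omega)
    rw [h1, h2, h3, Finset.sum_const, Finset.card_erase_of_mem (Finset.mem_univ _), Finset.card_univ,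
      Fintype.card_fin, nsmul_eq_mul, Nat.cast_sub (by omega : 1 ≤ N), Nat.cast_one]
  -- the contact identity at the right bath: `x₁ = -γ T y`, `y = ∫ p_{N-1} ∂_{p_{N-1}} u ρ`
  set y := ∫ x, x.2 b₁ * partialP b₁ u x * ρ x with hy
  have hC : x₁ = -(γ * T) * y :=
    integral_mul_lastBondCurrent_mul_gibbsDensity hω hl hβ hT hγ hu hu2 hJc hJ2 hJodd hpde'
      (i := i₁) (m := b₁) (by simp only [hb₁, hi₁]; omega) (by simp only [hb₁]; omega)
  -- Cauchy–Schwarz and equipartition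
  have hB1 : 0 < OscillatorChain.bathWeight N b₁ := by
    show (0 : ℝ) < (if b₁.val = 0 then (1 : ℝ) else 0) + if b₁.val = N - 1 then (1 : ℝ) else 0
    rw [if_neg (show b₁.val ≠ 0 by simp only [hb₁]; omega), if_pos (show b₁.val = N - 1 from rfl)]
    norm_num
  have hdu1 : MemLp (partialP b₁ u) 2 (P.gibbsMeasure N T) :=
    memLp_partialP_of_poisson hω hl hβ hγ hT hu hu2 hJ2 hpde' hB1
  have hp1 : MemLp (fun x : PhaseSpace N => x.2 b₁) 2 (P.gibbsMeasure N T) :=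
    memLp_of_integrable_sq_mul_gibbsDensity hω hl hβ γ N hT (by fun_prop)
      (pinnedChain_integrable_momentum_pow_mul_gibbsDensity hω hl hβ γ N hT b₁ (k := 2) (by norm_num))
  have hCS : y ^ 2 ≤ (∫ x, x.2 b₁ ^ 2 * ρ x) * D₁ :=
    sq_integral_mul_mul_gibbsDensity_le hω hl hβ hT γ hp1 hdu1
  have hp2 : ∫ x, x.2 b₁ ^ 2 * ρ x = T * Z := by
    have h := pinnedChain_integral_momentum_pow_add_two hω hl hβ γ N hT b₁ (k := 0) (Nat.zero_le _)
    simp only [Nat.cast_zero, zero_add, mul_one, pow_zero, one_mul] at h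
    exact h
  rw [hp2] at hCS
  -- the real arithmetic: `x₁² ≤ (γ T² Z (N-1)) x₁`
  have hNr : (1 : ℝ) ≤ (N : ℝ) - 1 := by
    have : (2 : ℝ) ≤ N := by exact_mod_cast hN
    linarith
  have hγTD : γ * T * D₁ ≤ A := by rw [hE]; nlinarith [mul_pos hγ hT]
  have h1 : x₁ ^ 2 ≤ (γ * T ^ 2 * Z * ((N : ℝ) - 1)) * x₁ := by
    calc x₁ ^ 2 = γ ^ 2 * T ^ 2 * y ^ 2 := by rw [hC]; ring
      _ ≤ γ ^ 2 * T ^ 2 * (T * Z * D₁) := by gcongr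
      _ = γ * T ^ 2 * Z * (γ * T * D₁) := by ring
      _ ≤ γ * T ^ 2 * Z * A := by gcongr
      _ = (γ * T ^ 2 * Z * ((N : ℝ) - 1)) * x₁ := by rw [hS]; ring
  have hc0 : 0 ≤ γ * T ^ 2 * Z * ((N : ℝ) - 1) := by
    have := hγ.le; have := hT.le; have := hZ0.le
    positivity
  have hx : x₁ ≤ γ * T ^ 2 * Z * ((N : ℝ) - 1) := by
    by_contra h
    have h' : γ * T ^ 2 * Z * ((N : ℝ) - 1) < x₁ := not_le.mp h
    have hxpos : 0 < x₁ := lt_of_le_of_lt hc0 h'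
    nlinarith
  calc A = ((N : ℝ) - 1) * x₁ := hS
    _ ≤ ((N : ℝ) - 1) * (γ * T ^ 2 * Z * ((N : ℝ) - 1)) := mul_le_mul_of_nonneg_left hx (by linarith)
    _ = γ * T ^ 2 * ((N : ℝ) - 1) ^ 2 * Z := by ring

end Pinned

/-- **The total Green–Kubo cap** for ANY `μ_T`-a.e. limit `u` of the finite-horizon Kubo
correctors `∫₀^τ P_t J dt` (`N ≥ 2`): `0 ≤ ∫ u J dμ_T ≤ γ T² (N-1)²`, `μ_T` the normalised Gibbs
measure. The finite-horizon correctors converge EVERYWHERE to `u⋆ = ∫₀^∞ P_t J dt`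
(`corrector_exists`), which is Lebesgue-a.e. the smooth corrector `u₀` of `corrector_smooth`;
hence `u = u₀` `μ_T`-a.e., and the density-form cap for `u₀` is divided by `Z = ∫ e^{-H/T}`.
[folklore] -/
theorem integral_mul_totalBondCurrent_gibbsMeasure_le {ω₂ lam β γ : ℝ} (hω : 0 < ω₂) (hl : 0 < lam)
    (hβ : 0 < β) (hγ : 0 < γ) {T : ℝ} (hT : 0 < T) (hN : 2 ≤ N) {u : PhaseSpace N → ℝ}
    (hlim : ∀ᵐ x ∂((pinnedChain ω₂ lam β γ).gibbsMeasure N T),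
      Tendsto (fun τ : ℝ => ∫ t in Set.Ioc (0 : ℝ) τ,
        (∫ y, (∑ i : Fin N, (pinnedChain ω₂ lam β γ).bondCurrent N i y)
          ∂((pinnedChain ω₂ lam β γ).transitionKernel N T T t.toNNReal x))) atTop (𝓝 (u x))) :
    0 ≤ ∫ z, u z * (∑ i : Fin N, (pinnedChain ω₂ lam β γ).bondCurrent N i z)
        ∂((pinnedChain ω₂ lam β γ).gibbsMeasure N T) ∧
      ∫ z, u z * (∑ i : Fin N, (pinnedChain ω₂ lam β γ).bondCurrent N i z)
          ∂((pinnedChain ω₂ lam β γ).gibbsMeasure N T) ≤ γ * T ^ 2 * ((N : ℝ) - 1) ^ 2 := by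
  set P := pinnedChain ω₂ lam β γ with hP
  have hN0 : 0 < N := by omega
  obtain ⟨u₀, hus, hae, hpde, hgrowth⟩ := corrector_smooth hω hl hβ hγ hT hN0
  have hϑ : 0 < 1 / (4 * T) := by positivity
  have h1ϑ : 1 / (4 * T) < 1 / T := by
    rw [div_lt_div_iff₀ (by positivity) hT]; nlinarith
  have h2ϑ : 2 * (1 / (4 * T)) < 1 / T := by
    rw [show 2 * (1 / (4 * T)) = 1 / (2 * T) by field_simp; ring, div_lt_div_iff₀ (by positivity) hT]
    nlinarith
  obtain ⟨K, c, -, -, -, -, -, -, hpt, -, -, -⟩ := corrector_exists hω hl hβ hγ hT hN0 hϑ h2ϑ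
    (fun s z => ∫ y, (∑ i : Fin N, P.bondCurrent N i y) ∂(P.transitionKernel N T T s.toNNReal z)) rfl
    (fun z => ∫ s in Set.Ioi (0 : ℝ), ∫ y, (∑ i : Fin N, P.bondCurrent N i y)
      ∂(P.transitionKernel N T T s.toNNReal z)) rfl
  obtain ⟨K₁, -, huK⟩ := hgrowth (1 / (4 * T)) hϑ h1ϑ
  have hu2g : MemLp u₀ 2 (P.gibbsMeasure N T) :=
    memLp_two_of_abs_le_exp hω hl.le hβ.le hT γ hus.continuous h2ϑ huK
  -- `u = u₀` `μ_T`-a.e.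
  have hae' : (fun x => ∫ t in Set.Ioi (0 : ℝ), ∫ y, (∑ i : Fin N, P.bondCurrent N i y)
      ∂(P.transitionKernel N T T t.toNNReal x)) =ᵐ[P.gibbsMeasure N T] u₀ :=
    (P.gibbsMeasure_absolutelyContinuous N T).ae_eq hae
  have huu₀ : u =ᵐ[P.gibbsMeasure N T] u₀ := by
    filter_upwards [hlim, hae'] with x hx hx'
    rw [← hx']
    exact tendsto_nhds_unique hx (hpt x)
  have hI : ∫ z, u z * (∑ i : Fin N, P.bondCurrent N i z) ∂(P.gibbsMeasure N T) =
      ∫ z, u₀ z * (∑ i : Fin N, P.bondCurrent N i z) ∂(P.gibbsMeasure N T) :=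
    integral_congr_ae (by filter_upwards [huu₀] with x hx; rw [hx])
  rw [hI, P.integral_gibbsMeasure]
  obtain ⟨h0, h1⟩ := integral_mul_totalBondCurrent_mul_gibbsDensity_le hω hl.le hβ.le hT hγ hN
    (hus.of_le (by norm_cast)) hu2g hpde
  have hZ : 0 < ∫ x, P.gibbsDensity N T x :=
    integral_exp_pos (pinnedChain_integrable_gibbsDensity hω hl.le hβ.le γ N hT)
  refine ⟨mul_nonneg (inv_nonneg.2 hZ.le) h0, ?_⟩
  calc (∫ x, P.gibbsDensity N T x)⁻¹ *
        ∫ x, u₀ x * (∑ i : Fin N, P.bondCurrent N i x) * P.gibbsDensity N T x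
      ≤ (∫ x, P.gibbsDensity N T x)⁻¹ * (γ * T ^ 2 * ((N : ℝ) - 1) ^ 2 * ∫ x, P.gibbsDensity N T x) :=
        mul_le_mul_of_nonneg_left h1 (inv_nonneg.2 hZ.le)
    _ = γ * T ^ 2 * ((N : ℝ) - 1) ^ 2 := by
        field_simp

/-- **S_B `stub_totalGreenKuboCap`** (registered stub of line tap-duality-gk-time, verbatim): the
total Green–Kubo integral `⟨u, J⟩_{μ_T}` of any `μ_T`-a.e. limit `u` of the finite-horizon Kubo
correctors is nonnegative and at most `γ T² (N−1)²` — the equilibrium conductance cap `G_N ≤ γ`.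
[folklore] -/
theorem stub_totalGreenKuboCap :
    ∀ ω₂ lam β γ : ℝ, 0 < ω₂ → 0 < lam → 0 < β → 0 < γ → ∀ T : ℝ, 0 < T →
      ∀ (N : ℕ) (u : PhaseSpace N → ℝ), 2 ≤ N →
        MemLp u 2 ((pinnedChain ω₂ lam β γ).gibbsMeasure N T) →
        (∀ᵐ x ∂((pinnedChain ω₂ lam β γ).gibbsMeasure N T),
          Tendsto (fun τ : ℝ => ∫ t in Set.Ioc (0 : ℝ) τ,
            (∫ y, (∑ i : Fin N, (pinnedChain ω₂ lam β γ).bondCurrent N i y)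
              ∂((pinnedChain ω₂ lam β γ).transitionKernel N T T t.toNNReal x))) atTop (𝓝 (u x))) →
        0 ≤ ∫ z, u z * (∑ i : Fin N, (pinnedChain ω₂ lam β γ).bondCurrent N i z)
            ∂((pinnedChain ω₂ lam β γ).gibbsMeasure N T) ∧
        ∫ z, u z * (∑ i : Fin N, (pinnedChain ω₂ lam β γ).bondCurrent N i z)
            ∂((pinnedChain ω₂ lam β γ).gibbsMeasure N T) ≤ γ * T ^ 2 * ((N : ℝ) - 1) ^ 2 :=
  fun _ _ _ _ hω hl hβ hγ _ hT _ _ hN _hu hlim =>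
    integral_mul_totalBondCurrent_gibbsMeasure_le hω hl hβ hγ hT hN hlim

end Summit.AtomisticToContinuum.FouriersLaw.Theorems.ExtensiveSnapshotIrreversibility.TapDuality

end
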